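import Literature.AlgebraicGeometry.Frobenioids.BaseSectionsOfObjectsCor57FSM
import Literature.AlgebraicGeometry.Frobenioids.ArithmeticFrobenioidStandard
import Literature.AlgebraicGeometry.Frobenioids.ArithmeticDivisorsPerfFactorial
import Literature.AlgebraicGeometry.Frobenioids.FinSubextCatFSM
import HarnessLib

/-!
# Frobenioids I, Corollary 5.7: the hypothesis package `Cor57Hypotheses` IS INHABITED — at the arithmetic
# Frobenioids `C_{K/F}` of Example 6.3 / Theorem 6.4 (non-vacuity row NV-L1/C)

Mochizuki, *The geometry of Frobenioids I*, Kyushu J. Math. **62** (2008), Cor. 5.7 p. 107 (standing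
hypotheses: "`Φ_i` perf-factorial; `D_i` Div-slim; `C_i` of standard type; … if `C₁`, `C₂` are of group-like
type, then both `Ψ` and some quasi-inverse to `Ψ` preserve base-isomorphisms"), Ex. 6.3 p. 113, Thm. 6.4 (i)
pp. 114–115 ("`C` … of … rationally standard type, but not of group-like type; `D` is … Div-slim")
[cite: MochizukiFrdI2008, Cor. 5.7 p.107] [cite: MochizukiFrdI2008, Thm. 6.4 (i) p.114].

PROOF-ONLY companion (abc-iut-L1-d1 gen 3; row «NV-L1/C» of L1-lead R111 (1)): the Prop-structure
`PreFrobenioid.Cor57Hypotheses F₁ F₂ Ψ` of `BaseSectionsOfObjects.lean` (abc-iut-L1-t5/d6; 17 consumers, 0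
producers in the w5-d056 kernel inhabitation census v3) is given GENUINE inhabitants — label
`nonempty_genuine`: every field is a theorem about THE constructed arithmetic model Frobenioids
`C_{K/F} = arithFrobenioid F K` (abc-iut-L6-t10 `arithFrobenioid_isFrobenioid`, `isOfStandardType_arith`,
`arithFrobenioidOps_isDivSlim`; abc-iut-L1-d2 `EffArithDivisor.isPerfFactorial`), for EVERY equivalence
`Ψ : C_{K₁/F₁} ⥲ C_{K₂/F₂}` (the setting of Thm. 6.4 (iv)); the group-like clause of Cor. 5.7 is IDLE at
arithmetic Frobenioids (they are not of group-like type, Thm. 6.4 (i): `not_isOfGroupLikeType_arith`) — and for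
`Ψ := Equivalence.refl` it also holds on the nose. No `nonempty_degenerate` instance is used.

* `cor57Hypotheses_arith` — `Cor57Hypotheses` for every `Ψ : C_{K₁/F₁} ≌ C_{K₂/F₂}`;
* `cor57Hypotheses_arith_refl` — the same at `Ψ := Equivalence.refl` (the R111-named instance);
* `cor411Setting_arith` — the Cor. 4.11 hypothesis package `PreFrobenioidData.Cor411Setting` likewise;
* `cor57i_sections_arith`, `cor57i_pairs_arith`, `isOfPreModelType_iff_arith`, `cor57ii_arith_of_cor411ii`,
  `cor57iii_arith`, `cor57iv_arith` — [FrdI] Cor. 5.7 (i)–(iv) AT the arithmetic Frobenioids (base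
  `D = FinSubextCat F K` of FSM-type, abc-iut-L6-t10 `FinSubextCat.isOfFSMType`; abc-iut-w4-d086's FSM closers
  of `BaseSectionsOfObjectsCor57FSM.lean`) — conditional ONLY on the typed Cor. 4.11 (ii) for `Ψ`
  (`PreFrobenioidData.Cor411ii`, BY NAME; its general FSM closer is abc-iut-L1-d6's).

No definitions, no new named facts; a zero row is «not yet witnessed», never «vacuous»; nothing here bears
on, or takes a side on, [IUTchIII] Cor. 3.12.
-/

noncomputable section

namespace Literature.AlgebraicGeometry.Frobenioids

open CategoryTheory Opposite
open PreFrobenioid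

section Arith

variable (F₁ : Type) [Field F₁] [NumberField F₁] (K₁ : Type) [Field K₁] [Algebra F₁ K₁] [IsGalois F₁ K₁]
variable (F₂ : Type) [Field F₂] [NumberField F₂] (K₂ : Type) [Field K₂] [Algebra F₂ K₂] [IsGalois F₂ K₂]

/-! ### The fields of `Cor57Hypotheses` at `C_{K/F}`, in the `ofFunctor ∘ toElem` language of the package -/

omit [IsGalois F₁ K₁] in
/-- `Φ : Spec L ↦ Φ(L)` is perf-factorial, objectwise ("`Φ(L) ≠ 0` is perf-factorial", Ex. 6.3 p. 113;
abc-iut-L1-d2's `EffArithDivisor.isPerfFactorial`). [cite: MochizukiFrdI2008, Ex. 6.3 p.113] -/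
theorem arith_objectwise_isPerfFactorial :
    Objectwise (fun M _ => IsPerfFactorial M) (arithDivisorFunctor F₁ K₁) :=
  fun X => EffArithDivisor.isPerfFactorial X.L

/-- `D = B(Gal(K/F))⁰` is Div-slim with respect to `Φ`, for the operations `ofFunctor Φ (toElem …)` of the
package (Thm. 6.4 (i) p. 114; abc-iut-L6-t10's `arithFrobenioidOps_isDivSlim`, the two packagings of the
operations agreeing definitionally, `ModelFrobenioid.ofModel_eq_data`). [cite: MochizukiFrdI2008, Thm. 6.4 (i) p.114] -/
theorem arith_ofFunctor_isDivSlim :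
    (PreFrobenioidData.ofFunctor (arithDivisorFunctor F₁ K₁)
      (ModelFrobenioid.toElem (arithDivisorFunctor F₁ K₁) (unitsFunctor F₁ K₁) (divNatTrans F₁ K₁))).IsDivSlim :=
  arithFrobenioidOps_isDivSlim F₁ K₁

/-- `C_{K/F}` is of standard type, for the operations `ofFunctor Φ (toElem …)` (Thm. 6.4 (i) p. 114;
abc-iut-L6-t10's `isOfStandardType_arith`). [cite: MochizukiFrdI2008, Thm. 6.4 (i) p.114] -/
theorem arith_ofFunctor_isOfStandardType :
    (PreFrobenioidData.ofFunctor (arithDivisorFunctor F₁ K₁)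
      (ModelFrobenioid.toElem (arithDivisorFunctor F₁ K₁) (unitsFunctor F₁ K₁) (divNatTrans F₁ K₁))).IsOfStandardType :=
  isOfStandardType_arith F₁ K₁

omit [IsGalois F₁ K₁] in
/-- `C_{K/F}` is NOT of group-like type: not every object is group-like ("`Φ` is nonzero [so `C` is not of
group-like type]", Thm. 6.4 (i) p. 115; abc-iut-L6-t10's `not_isOfGroupLikeType_arith`) — so the group-like
clause of Cor. 5.7 is idle here. [cite: MochizukiFrdI2008, Thm. 6.4 (i) p.115] -/
theorem arith_not_isOfType_isGroupLikeObj' :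
    ¬ IsOfType (IsGroupLikeObj
      (ModelFrobenioid.toElem (arithDivisorFunctor F₁ K₁) (unitsFunctor F₁ K₁) (divNatTrans F₁ K₁))) := by
  intro h
  exact not_isOfGroupLikeType_arith F₁ K₁
    ⟨fun A => (PreFrobenioidData.ofFunctor_isGroupLikeObj _ A).mpr (h A)⟩

/-! ### `Cor57Hypotheses` and `Cor411Setting` are inhabited at the arithmetic Frobenioids (nonempty_genuine) -/

/-- **nonempty_genuine — the standing hypotheses of [FrdI] Cor. 5.7 HOLD for every equivalence
`Ψ : C_{K₁/F₁} ⥲ C_{K₂/F₂}` between arithmetic Frobenioids** (Cor. 5.7 p. 107 at Ex. 6.3 / Thm. 6.4, pp. 113–115):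
`C_i` Frobenioids (Thm. 5.2 (ii)), `Φ_i` perf-factorial, `D_i` Div-slim, `C_i` of standard type (Thm. 6.4
(i)); the clause "if `C₁`, `C₂` are of group-like type, `Ψ` and a quasi-inverse preserve base-isomorphisms"
holds because arithmetic Frobenioids are NOT of group-like type (its antecedent is refuted — honest label:
this clause is idle here). [cite: MochizukiFrdI2008, Cor. 5.7 p.107] -/
theorem cor57Hypotheses_arith (Ψ : arithFrobenioid F₁ K₁ ≌ arithFrobenioid F₂ K₂) :
    Cor57Hypotheses
      (ModelFrobenioid.toElem (arithDivisorFunctor F₁ K₁) (unitsFunctor F₁ K₁) (divNatTrans F₁ K₁))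
      (ModelFrobenioid.toElem (arithDivisorFunctor F₂ K₂) (unitsFunctor F₂ K₂) (divNatTrans F₂ K₂)) Ψ where
  isFrobenioid₁ := arithFrobenioid_isFrobenioid F₁ K₁
  isFrobenioid₂ := arithFrobenioid_isFrobenioid F₂ K₂
  perfFactorial₁ := arith_objectwise_isPerfFactorial F₁ K₁
  perfFactorial₂ := arith_objectwise_isPerfFactorial F₂ K₂
  divSlim₁ := arith_ofFunctor_isDivSlim F₁ K₁
  divSlim₂ := arith_ofFunctor_isDivSlim F₂ K₂
  standard₁ := arith_ofFunctor_isOfStandardType F₁ K₁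
  standard₂ := arith_ofFunctor_isOfStandardType F₂ K₂
  baseIso_functor h₁ _ := absurd h₁ (arith_not_isOfType_isGroupLikeObj' F₁ K₁)
  baseIso_inverse h₁ _ := absurd h₁ (arith_not_isOfType_isGroupLikeObj' F₁ K₁)

/-- **nonempty_genuine — `Cor57Hypotheses` at `C_{K/F}` with `Ψ := Equivalence.refl`** (the instance named in
L1-lead R111 (1)); here the base-isomorphism clauses also hold on the nose (`𝟭` preserves everything), not
only through the refuted group-like antecedent. [cite: MochizukiFrdI2008, Cor. 5.7 p.107] -/
theorem cor57Hypotheses_arith_refl :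
    Cor57Hypotheses
      (ModelFrobenioid.toElem (arithDivisorFunctor F₁ K₁) (unitsFunctor F₁ K₁) (divNatTrans F₁ K₁))
      (ModelFrobenioid.toElem (arithDivisorFunctor F₁ K₁) (unitsFunctor F₁ K₁) (divNatTrans F₁ K₁))
      (CategoryTheory.Equivalence.refl (C := arithFrobenioid F₁ K₁)) where
  isFrobenioid₁ := arithFrobenioid_isFrobenioid F₁ K₁
  isFrobenioid₂ := arithFrobenioid_isFrobenioid F₁ K₁
  perfFactorial₁ := arith_objectwise_isPerfFactorial F₁ K₁
  perfFactorial₂ := arith_objectwise_isPerfFactorial F₁ K₁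
  divSlim₁ := arith_ofFunctor_isDivSlim F₁ K₁
  divSlim₂ := arith_ofFunctor_isDivSlim F₁ K₁
  standard₁ := arith_ofFunctor_isOfStandardType F₁ K₁
  standard₂ := arith_ofFunctor_isOfStandardType F₁ K₁
  baseIso_functor _ _ _ _ _ hf := hf
  baseIso_inverse _ _ _ _ _ hg := hg

/-- **nonempty_genuine — the Cor. 4.11 hypothesis package `Cor411Setting` HOLDS for every
`Ψ : C_{K₁/F₁} ⥲ C_{K₂/F₂}`** (Cor. 4.11 p. 91 at Thm. 6.4: Div-slim bases, standard type; hypothesis (b) idle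
since arithmetic Frobenioids are not of group-like type). [cite: MochizukiFrdI2008, Cor. 4.11 p.91] -/
theorem cor411Setting_arith (Ψ : arithFrobenioid F₁ K₁ ≌ arithFrobenioid F₂ K₂) :
    PreFrobenioidData.Cor411Setting (arithFrobenioidOps F₁ K₁) (arithFrobenioidOps F₂ K₂) Ψ where
  divSlim := ⟨arithFrobenioidOps_isDivSlim F₁ K₁, arithFrobenioidOps_isDivSlim F₂ K₂⟩
  standard := ⟨isOfStandardType_arith F₁ K₁, isOfStandardType_arith F₂ K₂⟩
  hypB h₁ _ := absurd h₁ (not_isOfGroupLikeType_arith F₁ K₁)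

/-! ### [FrdI] Cor. 5.7 (i)–(iv) AT the arithmetic Frobenioids, modulo only the typed Cor. 4.11 (ii) for `Ψ` -/

variable {F₁ K₁ F₂ K₂}

/-- **Cor. 5.7 (i), base-sections, at `Ψ : C_{K₁/F₁} ⥲ C_{K₂/F₂}`** (p. 107–108): `Ψ` maps every base-section of
`C_{K₁/F₁}` into a base-section of `C_{K₂/F₂}` — conditional only on the typed Cor. 4.11 (ii) for `Ψ`
(abc-iut-w4-d086's FSM closer fed with `cor57Hypotheses_arith`; `D_i` of FSM-type by abc-iut-L6-t10).
[cite: MochizukiFrdI2008, Cor. 5.7 (i) p.107] -/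
theorem cor57i_sections_arith (Ψ : arithFrobenioid F₁ K₁ ≌ arithFrobenioid F₂ K₂)
    (h411 : (arithFrobenioidOps F₁ K₁).Cor411ii (arithFrobenioidOps F₂ K₂) Ψ) :
    ∀ P₁ : Presection (arithFrobenioid F₁ K₁),
      IsBaseSection (ModelFrobenioid.toElem (arithDivisorFunctor F₁ K₁) (unitsFunctor F₁ K₁) (divNatTrans F₁ K₁))
        P₁ →
      ∃ P₂ : Presection (arithFrobenioid F₂ K₂),
        IsBaseSection (ModelFrobenioid.toElem (arithDivisorFunctor F₂ K₂) (unitsFunctor F₂ K₂)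
          (divNatTrans F₂ K₂)) P₂ ∧ MapsInto Ψ P₁ P₂ :=
  cor57i_sections_of_isOfFSMType _ _ Ψ (FinSubextCat.isOfFSMType F₁ K₁) (FinSubextCat.isOfFSMType F₂ K₂)
    h411 (cor57Hypotheses_arith F₁ K₁ F₂ K₂ Ψ)

/-- **Cor. 5.7 (i), quasi-base-Frobenius pairs, at `Ψ : C_{K₁/F₁} ⥲ C_{K₂/F₂}`** (p. 107–108) — conditional only
on the typed Cor. 4.11 (ii) for `Ψ`. [cite: MochizukiFrdI2008, Cor. 5.7 (i) p.107] -/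
theorem cor57i_pairs_arith (Ψ : arithFrobenioid F₁ K₁ ≌ arithFrobenioid F₂ K₂)
    (h411 : (arithFrobenioidOps F₁ K₁).Cor411ii (arithFrobenioidOps F₂ K₂) Ψ) :
    ∀ (P₁ : Presection (arithFrobenioid F₁ K₁)) (Fr₁ : ℕ+ →* End P₁.ι),
      IsBaseFrobeniusPair
        (ModelFrobenioid.toElem (arithDivisorFunctor F₁ K₁) (unitsFunctor F₁ K₁) (divNatTrans F₁ K₁)) P₁ Fr₁ →
      ∃ (P₂ : Presection (arithFrobenioid F₂ K₂)) (Fr₂ : ℕ+ →* End P₂.ι) (τ : ℕ+ ≃* ℕ+)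
        (h : MapsInto Ψ P₁ P₂),
        IsBaseFrobeniusPair
          (ModelFrobenioid.toElem (arithDivisorFunctor F₂ K₂) (unitsFunctor F₂ K₂) (divNatTrans F₂ K₂)) P₂ Fr₂ ∧
          ∀ (n : ℕ+) (A : arithFrobenioid F₁ K₁) (hA : P₁.obj A),
            Ψ.functor.map ((Fr₁ n).app ⟨A, hA⟩) = (Fr₂ (τ n)).app ⟨Ψ.functor.obj A, h.1 A hA⟩ :=
  cor57i_pairs_of_isOfFSMType _ _ Ψ (FinSubextCat.isOfFSMType F₁ K₁) (FinSubextCat.isOfFSMType F₂ K₂)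
    h411 (cor57Hypotheses_arith F₁ K₁ F₂ K₂ Ψ)

/-- **Cor. 5.7 (i), "in particular, `C₁` is of model type iff `C₂` is" (pre-model half), at
`Ψ : C_{K₁/F₁} ⥲ C_{K₂/F₂}`** — conditional only on the typed Cor. 4.11 (ii) for `Ψ` and `Ψ⁻¹`.
[cite: MochizukiFrdI2008, Cor. 5.7 (i) p.107] -/
theorem isOfPreModelType_iff_arith (Ψ : arithFrobenioid F₁ K₁ ≌ arithFrobenioid F₂ K₂)
    (h411 : (arithFrobenioidOps F₁ K₁).Cor411ii (arithFrobenioidOps F₂ K₂) Ψ)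
    (h411' : (arithFrobenioidOps F₂ K₂).Cor411ii (arithFrobenioidOps F₁ K₁) Ψ.symm) :
    IsOfPreModelType
        (ModelFrobenioid.toElem (arithDivisorFunctor F₁ K₁) (unitsFunctor F₁ K₁) (divNatTrans F₁ K₁)) ↔
      IsOfPreModelType
        (ModelFrobenioid.toElem (arithDivisorFunctor F₂ K₂) (unitsFunctor F₂ K₂) (divNatTrans F₂ K₂)) :=
  isOfPreModelType_iff_of_isOfFSMType _ _ Ψ (FinSubextCat.isOfFSMType F₁ K₁) (FinSubextCat.isOfFSMType F₂ K₂)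
    h411 h411' (cor57Hypotheses_arith F₁ K₁ F₂ K₂ Ψ)

/-- **Cor. 5.7 (ii) at `Ψ : C_{K₁/F₁} ⥲ C_{K₂/F₂}`** (p. 108): "`C₁` is of unit-profinite type iff `C₂` is" —
conditional only on the typed Cor. 4.11 (ii) for `Ψ` (abc-iut-L1-d6's `cor57ii_of_cor411ii`).
[cite: MochizukiFrdI2008, Cor. 5.7 (ii) p.108] -/
theorem cor57ii_arith_of_cor411ii (Ψ : arithFrobenioid F₁ K₁ ≌ arithFrobenioid F₂ K₂)
    (h411 : (arithFrobenioidOps F₁ K₁).Cor411ii (arithFrobenioidOps F₂ K₂) Ψ) :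
    IsOfUnitProfiniteType
        (ModelFrobenioid.toElem (arithDivisorFunctor F₁ K₁) (unitsFunctor F₁ K₁) (divNatTrans F₁ K₁)) ↔
      IsOfUnitProfiniteType
        (ModelFrobenioid.toElem (arithDivisorFunctor F₂ K₂) (unitsFunctor F₂ K₂) (divNatTrans F₂ K₂)) :=
  cor57ii_of_cor411ii _ _ Ψ h411 (cor57Hypotheses_arith F₁ K₁ F₂ K₂ Ψ)

/-- **Cor. 5.7 (iii) at `Ψ : C_{K₁/F₁} ⥲ C_{K₂/F₂}`** (p. 108; SCHEMA in the birationalization data `B_i` as in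
the typed `Cor57iii`) — conditional only on the typed Cor. 4.11 (ii) for `Ψ`. [cite: MochizukiFrdI2008, Cor. 5.7 (iii) p.108] -/
theorem cor57iii_arith (Ψ : arithFrobenioid F₁ K₁ ≌ arithFrobenioid F₂ K₂)
    (B₁ : (arithFrobenioidOps F₁ K₁).BiratData) (B₂ : (arithFrobenioidOps F₂ K₂).BiratData)
    (h411 : (arithFrobenioidOps F₁ K₁).Cor411ii (arithFrobenioidOps F₂ K₂) Ψ) :
    Cor57iii
      (ModelFrobenioid.toElem (arithDivisorFunctor F₁ K₁) (unitsFunctor F₁ K₁) (divNatTrans F₁ K₁))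
      (ModelFrobenioid.toElem (arithDivisorFunctor F₂ K₂) (unitsFunctor F₂ K₂) (divNatTrans F₂ K₂)) Ψ B₁ B₂ :=
  cor57iii_of_isOfFSMType
    (ModelFrobenioid.toElem (arithDivisorFunctor F₁ K₁) (unitsFunctor F₁ K₁) (divNatTrans F₁ K₁))
    (ModelFrobenioid.toElem (arithDivisorFunctor F₂ K₂) (unitsFunctor F₂ K₂) (divNatTrans F₂ K₂))
    Ψ B₁ B₂ (FinSubextCat.isOfFSMType F₁ K₁) (FinSubextCat.isOfFSMType F₂ K₂) h411

/-- **Cor. 5.7 (iii) at `Ψ`, conclusion form**: with `cor57Hypotheses_arith` supplied, only the typed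
Cor. 4.11 (ii) for `Ψ` remains as an input. [cite: MochizukiFrdI2008, Cor. 5.7 (iii) p.108] -/
theorem cor57iii_arith_conclusion (Ψ : arithFrobenioid F₁ K₁ ≌ arithFrobenioid F₂ K₂)
    (B₁ : (arithFrobenioidOps F₁ K₁).BiratData) (B₂ : (arithFrobenioidOps F₂ K₂).BiratData)
    (h411 : (arithFrobenioidOps F₁ K₁).Cor411ii (arithFrobenioidOps F₂ K₂) Ψ) :
    IsOfPreModelType
        (ModelFrobenioid.toElem (arithDivisorFunctor F₁ K₁) (unitsFunctor F₁ K₁) (divNatTrans F₁ K₁)) →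
      PreFrobenioidData.IsOfBiratFrobeniusNormalizedType B₁ →
      IsOfPreModelType
        (ModelFrobenioid.toElem (arithDivisorFunctor F₂ K₂) (unitsFunctor F₂ K₂) (divNatTrans F₂ K₂)) →
      PreFrobenioidData.IsOfBiratFrobeniusNormalizedType B₂ →
      IsOfUnitProfiniteType
        (ModelFrobenioid.toElem (arithDivisorFunctor F₁ K₁) (unitsFunctor F₁ K₁) (divNatTrans F₁ K₁)) →
      IsOfUnitProfiniteType
        (ModelFrobenioid.toElem (arithDivisorFunctor F₂ K₂) (unitsFunctor F₂ K₂) (divNatTrans F₂ K₂)) →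
      ∀ (A₁ : arithFrobenioid F₁ K₁)
        (σ₁ : Aut (baseObj (ModelFrobenioid.toElem (arithDivisorFunctor F₁ K₁) (unitsFunctor F₁ K₁)
          (divNatTrans F₁ K₁)) A₁) →* Aut A₁) (φ₁ : ℕ+ →* End A₁),
        IsFrobeniusTrivial
            (ModelFrobenioid.toElem (arithDivisorFunctor F₁ K₁) (unitsFunctor F₁ K₁) (divNatTrans F₁ K₁)) A₁ →
          IsQuasiBaseFrobeniusPairOfObj
            (ModelFrobenioid.toElem (arithDivisorFunctor F₁ K₁) (unitsFunctor F₁ K₁) (divNatTrans F₁ K₁))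
            A₁ σ₁ φ₁ →
          IsFrobeniusTrivial
              (ModelFrobenioid.toElem (arithDivisorFunctor F₂ K₂) (unitsFunctor F₂ K₂) (divNatTrans F₂ K₂))
              (Ψ.functor.obj A₁) ∧
            ∃ (σ₂ : Aut (baseObj (ModelFrobenioid.toElem (arithDivisorFunctor F₂ K₂) (unitsFunctor F₂ K₂)
                (divNatTrans F₂ K₂)) (Ψ.functor.obj A₁)) →* Aut (Ψ.functor.obj A₁))
              (φ₂ : ℕ+ →* End (Ψ.functor.obj A₁)) (τ : ℕ+ ≃* ℕ+),
              IsQuasiBaseFrobeniusPairOfObj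
                  (ModelFrobenioid.toElem (arithDivisorFunctor F₂ K₂) (unitsFunctor F₂ K₂) (divNatTrans F₂ K₂))
                  (Ψ.functor.obj A₁) σ₂ φ₂ ∧
                MapsPair
                  (ModelFrobenioid.toElem (arithDivisorFunctor F₁ K₁) (unitsFunctor F₁ K₁) (divNatTrans F₁ K₁))
                  (ModelFrobenioid.toElem (arithDivisorFunctor F₂ K₂) (unitsFunctor F₂ K₂) (divNatTrans F₂ K₂))
                  Ψ σ₁ φ₁ σ₂ φ₂ τ :=
  cor57iii_arith Ψ B₁ B₂ h411 (cor57Hypotheses_arith F₁ K₁ F₂ K₂ Ψ)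

/-- **Cor. 5.7 (iv) at `Ψ : C_{K₁/F₁} ⥲ C_{K₂/F₂}`** (p. 108; SCHEMA in `B_i`) — conditional only on the typed
Cor. 4.11 (ii) for `Ψ`. [cite: MochizukiFrdI2008, Cor. 5.7 (iv) p.108] -/
theorem cor57iv_arith (Ψ : arithFrobenioid F₁ K₁ ≌ arithFrobenioid F₂ K₂)
    (B₁ : (arithFrobenioidOps F₁ K₁).BiratData) (B₂ : (arithFrobenioidOps F₂ K₂).BiratData)
    (h411 : (arithFrobenioidOps F₁ K₁).Cor411ii (arithFrobenioidOps F₂ K₂) Ψ) :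
    Cor57iv
      (ModelFrobenioid.toElem (arithDivisorFunctor F₁ K₁) (unitsFunctor F₁ K₁) (divNatTrans F₁ K₁))
      (ModelFrobenioid.toElem (arithDivisorFunctor F₂ K₂) (unitsFunctor F₂ K₂) (divNatTrans F₂ K₂)) Ψ B₁ B₂ :=
  cor57iv_of_isOfFSMType
    (ModelFrobenioid.toElem (arithDivisorFunctor F₁ K₁) (unitsFunctor F₁ K₁) (divNatTrans F₁ K₁))
    (ModelFrobenioid.toElem (arithDivisorFunctor F₂ K₂) (unitsFunctor F₂ K₂) (divNatTrans F₂ K₂))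
    Ψ B₁ B₂ (FinSubextCat.isOfFSMType F₁ K₁) (FinSubextCat.isOfFSMType F₂ K₂) h411

end Arith

end Literature.AlgebraicGeometry.Frobenioids

end
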